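import Mathlib.Geometry.Manifold.SmoothEmbedding
import Mathlib.Geometry.Manifold.ContMDiff.Atlas
import HarnessLib

/-!
# Restricting the codomain of an immersion / smooth embedding to an open subset

Mathlib-level helper (topic `Literature/Geometry/Manifold`): if `f : X → M` is a `C^n` immersion
(resp. smooth embedding) at `x` and takes values in the open subset `U ⊆ M`, then so is the
codomain-restricted map `f : X → U` into the open submanifold `U` (Mathlib's
`TopologicalSpace.Opens` charted-space structure, whose charts are the restricted charts of `M`).
The codomain chart of the normal form of `f` at `x` (a chart of the *maximal* atlas of `M`) is
restricted to `U` (`OpenPartialHomeomorph.subtypeRestr`), which is a chart of the maximal atlas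
of `U` (`subtypeRestr_mem_maximalAtlas_of_mem_maximalAtlas`, the maximal-atlas version of
Mathlib's `StructureGroupoid.subtypeRestr_mem_maximalAtlas`); the normal form is unchanged.
Standard differential topology: J. M. Lee, *Introduction to Smooth Manifolds*, 2nd ed. (2013),
Ch. 5 (restricting the codomain of a smooth embedding to an open submanifold containing its
image). [folklore]

refactor: the tree already has `Manifold.IsImmersionAtOfComplement.codRestrict_opens`
(`Literature/Topology/FourManifolds/CorkDecompositionSplittingProof.lean`) and
`Manifold.IsImmersion.codRestrict_opens`, `Manifold.IsSmoothEmbedding.codRestrict_opens`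
(`Literature/Topology/FourManifolds/NeckCapping.lean`), for regularity `∞`, inside files whose
import closure is the four-manifold surgery theory; the present Mathlib-only restatements (names
`…opensCodRestrict`, any regularity `n`, via the maximal-atlas lemma) exist to keep that theory out
of the import closure of the Lorentzian Cauchy-development files, exactly as
`HypersurfaceRestriction.hasMFDerivAt_subtypeVal` restates a connected-sum lemma. The librarian may
merge the two families.

All results proved; no definitions.
-/

open scoped Manifold ContDiff Topology
open Function Set TopologicalSpace

noncomputable section

namespace Manifold

universe u

variable {E : Type*} {E' : Type u} {F : Type*} [NormedAddCommGroup E] [NormedSpace ℝ E]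
  [NormedAddCommGroup E'] [NormedSpace ℝ E'] [NormedAddCommGroup F] [NormedSpace ℝ F]
  {H : Type*} [TopologicalSpace H] {G : Type*} [TopologicalSpace G]
  {I : ModelWithCorners ℝ E H} {J : ModelWithCorners ℝ E' G}
  {X : Type*} [TopologicalSpace X] [ChartedSpace H X]
  {M : Type*} [TopologicalSpace M] [ChartedSpace G M]
  {n : ℕ∞ω} {f : X → M}

/-- **A chart of the maximal atlas restricts to a chart of the maximal atlas of an open
subset.** (Mathlib's `StructureGroupoid.subtypeRestr_mem_maximalAtlas` assumes the chart lies in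
the atlas itself.) The transition maps with the charts of `U` — restrictions of charts of `M`
(`TopologicalSpace.Opens.chart_eq`) — are restrictions of transition maps of `M`
(`OpenPartialHomeomorph.subtypeRestr_symm_trans_subtypeRestr`). [folklore] -/
theorem subtypeRestr_mem_maximalAtlas_of_mem_maximalAtlas [IsManifold J n M]
    {e : OpenPartialHomeomorph M G} (he : e ∈ IsManifold.maximalAtlas J n M) (U : Opens M)
    (hU : Nonempty U) : e.subtypeRestr hU ∈ IsManifold.maximalAtlas J n U := by
  rw [IsManifold.maximalAtlas, mem_maximalAtlas_iff]
  intro c hc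
  obtain ⟨x, rfl⟩ := Opens.chart_eq hU hc
  constructor
  · refine (contDiffGroupoid n J).mem_of_eqOnSource ?_
      (OpenPartialHomeomorph.subtypeRestr_symm_trans_subtypeRestr (s := U) hU e (chartAt G (x : M)))
    exact closedUnderRestriction'
      (StructureGroupoid.compatible_of_mem_maximalAtlas_left he)
      (e.isOpen_inter_preimage_symm U.2)
  · refine (contDiffGroupoid n J).mem_of_eqOnSource ?_
      (OpenPartialHomeomorph.subtypeRestr_symm_trans_subtypeRestr (s := U) hU (chartAt G (x : M)) e)
    exact closedUnderRestriction'
      (StructureGroupoid.compatible_of_mem_maximalAtlas_right he)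
      ((chartAt G (x : M)).isOpen_inter_preimage_symm U.2)

/-- **Restricting the codomain of an immersion (with chosen complement) to an open subset
containing the image.** [folklore] -/
theorem IsImmersionAtOfComplement.opensCodRestrict [IsManifold J n M] {x : X}
    (hf : IsImmersionAtOfComplement F I J n f x) (U : Opens M) (hU : ∀ y, f y ∈ U) :
    IsImmersionAtOfComplement F I J n (fun y ↦ (⟨f y, hU y⟩ : U)) x := by
  haveI hne : Nonempty U := ⟨⟨f x, hU x⟩⟩
  refine IsImmersionAtOfComplement.mk_of_charts hf.equiv hf.domChart
    (hf.codChart.subtypeRestr hne) hf.mem_domChart_source ?_ hf.domChart_mem_maximalAtlas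
    (subtypeRestr_mem_maximalAtlas_of_mem_maximalAtlas hf.codChart_mem_maximalAtlas U hne) ?_ ?_
  · rw [OpenPartialHomeomorph.subtypeRestr_source]
    exact hf.mem_codChart_source
  · intro y hy
    rw [mem_preimage, OpenPartialHomeomorph.subtypeRestr_source]
    exact hf.source_subset_preimage_source hy
  · intro z hz
    have h := hf.writtenInCharts hz
    simp only [comp_apply] at h ⊢
    rw [← h, OpenPartialHomeomorph.extend_coe, OpenPartialHomeomorph.extend_coe]
    rfl

/-- **Restricting the codomain of an immersion at a point to an open subset containing the
image.** [folklore] -/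
theorem IsImmersionAt.opensCodRestrict [IsManifold J n M] {x : X}
    (hf : IsImmersionAt I J n f x) (U : Opens M) (hU : ∀ y, f y ∈ U) :
    IsImmersionAt I J n (fun y ↦ (⟨f y, hU y⟩ : U)) x := by
  obtain ⟨F', i₁, i₂, h⟩ := hf
  exact ⟨F', i₁, i₂, h.opensCodRestrict U hU⟩

/-- **Restricting the codomain of an immersion to an open subset containing the image.**
[folklore] -/
theorem IsImmersion.opensCodRestrict [IsManifold J n M] (hf : IsImmersion I J n f) (U : Opens M)
    (hU : ∀ y, f y ∈ U) : IsImmersion I J n (fun y ↦ (⟨f y, hU y⟩ : U)) := by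
  obtain ⟨F', i₁, i₂, h⟩ := hf
  exact ⟨F', i₁, i₂, fun x ↦ (h x).opensCodRestrict U hU⟩

/-- **Restricting the codomain of a smooth embedding to an open subset containing the image**
gives a smooth embedding into the open submanifold (immersion part: `IsImmersion.opensCodRestrict`;
topological part: Mathlib's `Topology.IsEmbedding.codRestrict`). Lee 2013, Ch. 5. [folklore] -/
theorem IsSmoothEmbedding.opensCodRestrict [IsManifold J n M] (hf : IsSmoothEmbedding I J n f)
    (U : Opens M) (hU : ∀ y, f y ∈ U) : IsSmoothEmbedding I J n (fun y ↦ (⟨f y, hU y⟩ : U)) :=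
  ⟨hf.isImmersion.opensCodRestrict U hU, hf.isEmbedding.codRestrict (U : Set M) hU⟩

end Manifold

end
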